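import Literature.NumberTheory.EllipticCurves.LeadingTermBSZLocalDensityProofs
import Literature.NumberTheory.EllipticCurves.LeadingTermBSZResidueCountProofs
import Mathlib.NumberTheory.Padics.PadicVal.Basic
import Mathlib.NumberTheory.LegendreSymbol.QuadraticChar.Basic
import HarnessLib

/-!
# Bhargava–Skinner–Zhang, proof of Lemma 19: `μ_ℓ{ℓ ∤ A, ord_ℓ Δ(A,B) = k} = (ℓ-1)²/ℓ^{k+2}`

`Proofs` companion of `Literature/NumberTheory/EllipticCurves/LeadingTerm.lean` (bsd.S27,
`Literature.NumberTheory.EllipticCurves.bhargava_skinner_zhang`), continuing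
`LeadingTermBSZLocalDensityProofs.lean` (one-prime local density formula `hasHeightDensity_residues`)
and `LeadingTermBSZResidueCountProofs.lean` (the disc bijection `bsz_lemma18_card_residues_eq`).
Source: M. Bhargava, C. Skinner, W. Zhang, *A majority of elliptic curves over `ℚ` satisfy the Birch
and Swinnerton-Dyer conjecture*, arXiv:1407.1826 (2014), proof of Lemma 19 (p. 9):

> "We note that for a prime `ℓ ≥ 5`, the measure of the set of `(A,B) ∈ ℤ_ℓ²` that satisfy `ℓ ∤ A`
> and `ord_ℓ(Δ(A,B)) = k` for a given integer `k > 0` is `(ℓ-1)²/ℓ^{k+2}`. For given an `A`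
> belonging to one of the `(ℓ-1)/2` primitive residue classes modulo `ℓ` for which
> `27B² ≡ -4A³ (mod ℓ)` is solvable in `B`, we have `ord_ℓ(Δ(A,B)) = k` if and only if `B` belongs
> to one of `2(ℓ-1)` residue classed modulo `ℓ^{k+1}` (which may depend on `A` modulo `ℓ^{k+1}`)."

This file PROVES this display as a height density over the family:

* `BSZLemma19.card_admissible_mod` — exactly `(ℓ-1)/2` nonzero classes `A (mod ℓ)` make
  `27B² ≡ -4A³` solvable (`ℓ ≥ 5`): solvability is `-3A ≡ □`, as `-4A³/27 = (2A/9)²·(-3A)`, and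
  the nonzero squares number `(ℓ-1)/2` (`card_nonzero_squares`, from `quadraticChar_sum_zero`);
* `BSZLemma19.exists_unit_residue_iff` — `ord_ℓ D = k` as the residue condition
  `D ≡ ℓ^k z (mod ℓ^{k+2})`, `z (mod ℓ²)` a unit (their number is `ℓ(ℓ-1)`, `card_units_mod_sq`);
* `hasHeightDensity_ord_disc_eq` — **for a prime `ℓ ≥ 5` and `k ≥ 1`, `{ℓ ∤ A, ℓ^k ∥ 4A³+27B²}` has
  height density `(ℓ-1)²/ℓ^{k+2} · (1-ℓ⁻¹⁰)⁻¹`** (the printed `ℓ`-adic measure divided by the measure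
  `1-ℓ⁻¹⁰` of the family, `hasHeightDensity_residues`): the residue set modulo `ℓ^{k+2}` has
  `((ℓ-1)/2 · ℓ^{k+1}) · 2ℓ(ℓ-1) = (ℓ-1)² ℓ^{k+2}` elements (`bsz_lemma18_card_residues_eq` with `Z` =
  the units modulo `ℓ²`); `hasHeightDensity_padicValInt_disc_eq` is the same with
  `ord_ℓ(4A³+27B²) = k` (`= ord_ℓ Δ(A,B)` as `Δ = -16(4A³+27B²)`, `ℓ ≠ 2`).

The remaining (multi-prime) content of Lemma 19 — the product of these local densities over all
`ℓ ≡ ±1 (mod p)` — is the "large family" sieve of [BS2] and is not treated here. No definitions and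
no named facts are introduced (D-0026).

## References

* M. Bhargava, C. Skinner, W. Zhang, arXiv:1407.1826 (2014), proof of Lemma 19 (p. 9), first
  display. [cite: BhargavaSkinnerZhang2014, Lemma 19 (proof)]
-/

noncomputable section

open Filter Topology

open scoped Classical

namespace Literature.NumberTheory.EllipticCurves

namespace BSZLemma19

variable {p : ℕ} [hp : Fact p.Prime]

/-! ### Squares and admissible classes modulo `p` -/

/-- In `ℤ/p`, `p` an odd prime, the nonzero squares number `(p-1)/2` (from `Σ_a χ(a) = 0` for the
quadratic character). [folklore] -/
theorem card_nonzero_squares (hp2 : p ≠ 2) :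
    ((Finset.univ : Finset (ZMod p)).filter (fun c ↦ c ≠ 0 ∧ IsSquare c)).card = (p - 1) / 2 := by
  have hchar : ringChar (ZMod p) ≠ 2 := by rw [ZMod.ringChar_zmod_n]; exact hp2
  have hsum := quadraticChar_sum_zero hchar
  set Sq := (Finset.univ : Finset (ZMod p)).filter (fun c ↦ c ≠ 0 ∧ IsSquare c) with hSq
  set NSq := (Finset.univ : Finset (ZMod p)).filter (fun c ↦ c ≠ 0 ∧ ¬ IsSquare c) with hNSq
  -- `Σ χ = #Sq - #NSq`
  have hval : ∀ a : ZMod p, (quadraticChar (ZMod p) a : ℤ) =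
      (if a ≠ 0 ∧ IsSquare a then 1 else 0) - (if a ≠ 0 ∧ ¬ IsSquare a then 1 else 0) := by
    intro a
    by_cases ha : a = 0
    · simp [ha, quadraticChar_eq_zero_iff.mpr]
    · by_cases hs : IsSquare a
      · rw [(quadraticChar_one_iff_isSquare ha).mpr hs]; simp [ha, hs]
      · rw [quadraticChar_neg_one_iff_not_isSquare.mpr hs]; simp [ha, hs]
  have hsum' : (Sq.card : ℤ) - NSq.card = 0 := by
    rw [← hsum, Finset.sum_congr rfl fun a _ ↦ hval a, Finset.sum_sub_distrib]
    simp only [Finset.sum_boole, hSq, hNSq]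
  -- `#Sq + #NSq = p - 1`
  have hunion : Sq ∪ NSq = (Finset.univ : Finset (ZMod p)).filter (fun c ↦ c ≠ 0) := by
    ext c
    simp only [hSq, hNSq, Finset.mem_union, Finset.mem_filter, Finset.mem_univ, true_and]
    tauto
  have hdisj : Disjoint Sq NSq := by
    rw [hSq, hNSq, Finset.disjoint_filter]
    intro c _ h1 h2
    exact h2.2 h1.2
  have hcard : Sq.card + NSq.card = p - 1 := by
    rw [← Finset.card_union_of_disjoint hdisj, hunion, Finset.filter_ne' Finset.univ (0 : ZMod p),
      Finset.card_erase_of_mem (Finset.mem_univ _), Finset.card_univ, ZMod.card]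
  omega

/-- `27 ≠ 0`, `2 ≠ 0`, `3 ≠ 0`, `9 ≠ 0` modulo a prime `p ≥ 5`. [folklore] -/
theorem units_mod (hp5 : 5 ≤ p) :
    (27 : ZMod p) ≠ 0 ∧ (2 : ZMod p) ≠ 0 ∧ (3 : ZMod p) ≠ 0 ∧ (9 : ZMod p) ≠ 0 := by
  have h27 := BSZLemma18.twentyseven_ne_zero_zmod (p := p) hp5
  have h2 := BSZLemma18.two_ne_zero_zmod (q := p) hp5
  have h3 : (3 : ZMod p) ≠ 0 := by
    intro h
    apply h27
    rw [show (27 : ZMod p) = 3 * 3 * 3 by norm_num, h]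
    ring
  refine ⟨h27, h2, h3, ?_⟩
  rw [show (9 : ZMod p) = 3 * 3 by norm_num]
  exact mul_ne_zero h3 h3

/-- For `a ≢ 0 (mod p)`, `p ≥ 5`: `27b² ≡ -4a³` is solvable iff `-3a` is a square
(`-4a³/27 = (2a/9)²·(-3a)`). [cite: BhargavaSkinnerZhang2014, Lemma 19 (proof)] -/
theorem solvable_iff_isSquare (hp5 : 5 ≤ p) {a : ZMod p} (ha : a ≠ 0) :
    (∃ b : ZMod p, 4 * a ^ 3 + 27 * b ^ 2 = 0) ↔ IsSquare (-3 * a) := by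
  obtain ⟨h27, h2, h3, h9⟩ := units_mod hp5
  constructor
  · rintro ⟨b, hb⟩
    -- `-3a = (9b/(2a))²`
    set f : ZMod p := (2 * a)⁻¹ with hf
    have hf' : 2 * a * f = 1 := mul_inv_cancel₀ (mul_ne_zero h2 ha)
    refine ⟨9 * b * f, ?_⟩
    linear_combination (-3 * f ^ 2) * hb + (3 * a * (1 + 2 * a * f)) * hf'
  · rintro ⟨r, hr⟩
    -- `b = 2a r/9`
    set e : ZMod p := (9 : ZMod p)⁻¹ with he
    have he' : 9 * e = 1 := mul_inv_cancel₀ h9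
    refine ⟨2 * a * r * e, ?_⟩
    linear_combination (108 * a ^ 2 * e ^ 2) * hr.symm + (-4 * a ^ 3 * (9 * e + 1)) * he'

/-- **Exactly `(p-1)/2` nonzero classes `A (mod p)` make `27B² ≡ -4A³ (mod p)` solvable** (`p ≥ 5`;
the source: "one of the `(ℓ-1)/2` primitive residue classes modulo `ℓ` for which `27B² ≡ -4A³` is
solvable"). [cite: BhargavaSkinnerZhang2014, Lemma 19 (proof)] -/
theorem card_admissible_mod (hp5 : 5 ≤ p) :
    ((Finset.univ : Finset (ZMod p)).filter
      (fun a ↦ a ≠ 0 ∧ ∃ b : ZMod p, 4 * a ^ 3 + 27 * b ^ 2 = 0)).card = (p - 1) / 2 := by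
  obtain ⟨-, -, h3, -⟩ := units_mod hp5
  have hp2 : p ≠ 2 := by omega
  have hm3 : (-3 : ZMod p) ≠ 0 := neg_ne_zero.mpr h3
  -- the bijection `a ↦ -3a` onto the nonzero squares
  rw [← card_nonzero_squares hp2]
  refine Finset.card_bij (fun a _ ↦ -3 * a) ?_ ?_ ?_
  · intro a ha
    rw [Finset.mem_filter] at ha ⊢
    exact ⟨Finset.mem_univ _, mul_ne_zero hm3 ha.2.1, (solvable_iff_isSquare hp5 ha.2.1).mp ha.2.2⟩
  · intro a _ a' _ h
    exact mul_left_cancel₀ hm3 h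
  · intro c hc
    rw [Finset.mem_filter] at hc
    refine ⟨c / (-3), ?_, by field_simp⟩
    rw [Finset.mem_filter]
    have hc0 : c / (-3) ≠ 0 := div_ne_zero hc.2.1 hm3
    refine ⟨Finset.mem_univ _, hc0, (solvable_iff_isSquare hp5 hc0).mpr ?_⟩
    rw [show (-3 : ZMod p) * (c / -3) = c by field_simp]
    exact hc.2.2

/-! ### Units modulo `p²` and the residue condition `ord_p = k` -/

omit hp in
/-- `p ∣ p²`. [folklore] -/
theorem dvd_sq : p ∣ p ^ 2 := dvd_pow_self p two_ne_zero

omit hp in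
/-- `p ∣ p^{k+2}` (the proof term of `bsz_lemma18_card_residues_eq`). [folklore] -/
theorem dvd_pow (k : ℕ) : p ∣ p ^ (k + 2) := dvd_pow_self p (Nat.succ_ne_zero (k + 1))

/-- The reduction of `z (mod p²)` modulo `p` vanishes iff `p ∣ z.val`. [folklore] -/
theorem castHom_eq_zero_iff_dvd_val (z : ZMod (p ^ 2)) :
    ZMod.castHom dvd_sq (ZMod p) z = 0 ↔ p ∣ z.val := by
  haveI : NeZero (p ^ 2) := ⟨pow_ne_zero 2 hp.out.ne_zero⟩
  rw [← ZMod.natCast_zmod_val z, map_natCast, ZMod.natCast_eq_zero_iff, ZMod.natCast_zmod_val]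

/-- Each fibre of `ZMod p^n → ZMod p` (`n ≥ 1`) has `p^{n-1}` elements; here for `n = m + 1`.
[folklore] -/
theorem card_fibre {m : ℕ} (h : p ∣ p ^ (m + 1)) (b : ZMod p) :
    ((Finset.univ : Finset (ZMod (p ^ (m + 1)))).filter
      (fun a ↦ ZMod.castHom h (ZMod p) a = b)).card = p ^ m := by
  haveI : NeZero (p ^ (m + 1)) := ⟨pow_ne_zero _ hp.out.ne_zero⟩
  set c := ((Finset.univ : Finset (ZMod (p ^ (m + 1)))).filter
      (fun a ↦ ZMod.castHom h (ZMod p) a = 0)).card with hc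
  have hall : ∀ b' : ZMod p, ((Finset.univ : Finset (ZMod (p ^ (m + 1)))).filter
      (fun a ↦ ZMod.castHom h (ZMod p) a = b')).card = c :=
    fun b' ↦ BSZLemma18.card_filter_castHom_eq h b'
  have hsum := Finset.card_eq_sum_card_fiberwise (s := (Finset.univ : Finset (ZMod (p ^ (m + 1)))))
    (t := (Finset.univ : Finset (ZMod p))) (f := fun a ↦ ZMod.castHom h (ZMod p) a)
    (fun _ _ ↦ Finset.mem_univ _)
  simp only [hall, Finset.sum_const, Finset.card_univ, ZMod.card, smul_eq_mul] at hsum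
  rw [hall]
  rw [pow_succ'] at hsum
  exact (Nat.eq_of_mul_eq_mul_left hp.out.pos hsum).symm

/-- The units modulo `p²` (residues with nonzero reduction mod `p`) number `p(p-1)`. [folklore] -/
theorem card_units_mod_sq :
    ((Finset.univ : Finset (ZMod (p ^ 2))).filter
      (fun z ↦ ZMod.castHom dvd_sq (ZMod p) z ≠ 0)).card = p * (p - 1) := by
  haveI : NeZero (p ^ 2) := ⟨pow_ne_zero 2 hp.out.ne_zero⟩
  have h0 := card_fibre (m := 1) (dvd_sq (p := p)) 0
  rw [pow_one] at h0
  simp only [ne_eq, Finset.filter_not, Finset.card_sdiff_of_subset (Finset.filter_subset _ _),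
    Finset.card_univ, ZMod.card, h0]
  rw [pow_two, Nat.mul_sub_one]

/-- **`ord_p D = k` as a residue condition modulo `p^{k+2}`** (`k ≥ 0`): `D ≡ p^k z (mod p^{k+2})` for
some `z (mod p²)` with `z ≢ 0 (mod p)` iff `p^k ∣ D` and `p^{k+1} ∤ D`. [folklore] -/
theorem exists_unit_residue_iff {k : ℕ} (D : ℤ) :
    (∃ z : ZMod (p ^ 2), ZMod.castHom dvd_sq (ZMod p) z ≠ 0 ∧
        (D : ZMod (p ^ (k + 2))) = (p : ZMod (p ^ (k + 2))) ^ k * (z.val : ZMod (p ^ (k + 2)))) ↔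
      (p : ℤ) ^ k ∣ D ∧ ¬ (p : ℤ) ^ (k + 1) ∣ D := by
  haveI : NeZero (p ^ 2) := ⟨pow_ne_zero 2 hp.out.ne_zero⟩
  have hp0 : (p : ℤ) ≠ 0 := by exact_mod_cast hp.out.ne_zero
  constructor
  · rintro ⟨z, hz, hD⟩
    have hD' : (D : ZMod (p ^ (k + 2))) = ((p ^ k * z.val : ℕ) : ℤ) := by
      rw [hD]; push_cast; ring
    rw [ZMod.intCast_eq_intCast_iff] at hD'
    obtain ⟨t, ht⟩ := Int.ModEq.dvd hD'.symm
    push_cast at ht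
    have hDeq : D = (p : ℤ) ^ k * (z.val : ℤ) + (p : ℤ) ^ (k + 2) * t := by linear_combination ht
    refine ⟨⟨(z.val : ℤ) + (p : ℤ) ^ 2 * t, by rw [hDeq]; ring⟩, fun ⟨w, hw⟩ ↦ hz ?_⟩
    rw [castHom_eq_zero_iff_dvd_val]
    have h5 : (p : ℤ) ∣ (z.val : ℤ) := by
      have : (p : ℤ) ^ (k + 1) ∣ (p : ℤ) ^ k * ((z.val : ℤ) + (p : ℤ) ^ 2 * t) := by
        rw [show (p : ℤ) ^ k * ((z.val : ℤ) + (p : ℤ) ^ 2 * t) = D by rw [hDeq]; ring]; exact ⟨w, hw⟩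
      rw [pow_succ] at this
      have h' := (mul_dvd_mul_iff_left (pow_ne_zero k hp0)).mp this
      have hpt : (p : ℤ) ∣ (p : ℤ) ^ 2 * t := ⟨p * t, by ring⟩
      exact (dvd_add_right hpt).mp (by simpa [add_comm] using h')
    exact_mod_cast h5
  · rintro ⟨⟨u, hu⟩, hnot⟩
    refine ⟨(u : ZMod (p ^ 2)), ?_, ?_⟩
    · rw [map_intCast, ne_eq, ZMod.intCast_zmod_eq_zero_iff_dvd]
      rintro ⟨w, hw⟩
      exact hnot ⟨w, by rw [hu, hw]; ring⟩
    · have hval : ((u : ZMod (p ^ 2)).val : ℤ) ≡ u [ZMOD (p ^ 2 : ℕ)] := by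
        rw [ZMod.val_intCast]
        exact Int.mod_modEq u _
      have hmul : (p : ℤ) ^ k * ((u : ZMod (p ^ 2)).val : ℤ) ≡ (p : ℤ) ^ k * u
          [ZMOD (p ^ (k + 2) : ℕ)] := by
        have h := Int.ModEq.mul_left' (c := (p : ℤ) ^ k) hval
        have hn : ((p ^ (k + 2) : ℕ) : ℤ) = (p : ℤ) ^ k * ((p ^ 2 : ℕ) : ℤ) := by push_cast; ring
        rwa [hn]
      have : (((p : ℤ) ^ k * u : ℤ) : ZMod (p ^ (k + 2))) =
          (((p : ℤ) ^ k * ((u : ZMod (p ^ 2)).val : ℤ) : ℤ) : ZMod (p ^ (k + 2))) :=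
        (ZMod.intCast_eq_intCast_iff _ _ _).mpr hmul.symm
      rw [hu, this]
      push_cast
      ring

/-! ### The count modulo `p^{k+2}` -/

/-- The classes `a (mod p^{k+2})` whose reduction modulo `p` is nonzero and admissible number
`(p-1)/2 · p^{k+1}`. [cite: BhargavaSkinnerZhang2014, Lemma 19 (proof)] -/
theorem card_admissible (hp5 : 5 ≤ p) (k : ℕ) :
    ((Finset.univ : Finset (ZMod (p ^ (k + 2)))).filter (fun a ↦
      ZMod.castHom (dvd_pow k) (ZMod p) a ≠ 0 ∧
        ∃ b : ZMod p, 4 * (ZMod.castHom (dvd_pow k) (ZMod p) a) ^ 3 + 27 * b ^ 2 = 0)).card =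
      (p - 1) / 2 * p ^ (k + 1) := by
  haveI : NeZero (p ^ (k + 2)) := ⟨pow_ne_zero _ hp.out.ne_zero⟩
  set red := ZMod.castHom (dvd_pow k) (ZMod p) with hred
  set S := (Finset.univ : Finset (ZMod p)).filter
      (fun a ↦ a ≠ 0 ∧ ∃ b : ZMod p, 4 * a ^ 3 + 27 * b ^ 2 = 0) with hS
  have hfib : ∀ s : ZMod p, ((Finset.univ : Finset (ZMod (p ^ (k + 2)))).filter
      (fun a ↦ red a = s)).card = p ^ (k + 1) := fun s ↦ card_fibre (m := k + 1) (dvd_pow k) s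
  have heq : (Finset.univ : Finset (ZMod (p ^ (k + 2)))).filter (fun a ↦
      red a ≠ 0 ∧ ∃ b : ZMod p, 4 * (red a) ^ 3 + 27 * b ^ 2 = 0) =
      (Finset.univ : Finset (ZMod (p ^ (k + 2)))).filter (fun a ↦ red a ∈ S) := by
    ext a
    simp [hS]
  have hsum := Finset.card_eq_sum_card_fiberwise
    (s := (Finset.univ : Finset (ZMod (p ^ (k + 2)))).filter (fun a ↦ red a ∈ S)) (t := S) (f := red)
    (fun a ha ↦ (Finset.mem_filter.mp ha).2)
  rw [heq, hsum]
  have hinner : ∀ s ∈ S, (((Finset.univ : Finset (ZMod (p ^ (k + 2)))).filter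
      (fun a ↦ red a ∈ S)).filter (fun a ↦ red a = s)).card = p ^ (k + 1) := by
    intro s hs
    rw [← hfib s, Finset.filter_filter]
    congr 1
    ext a
    simp only [Finset.mem_filter, Finset.mem_univ, true_and]
    exact ⟨fun h ↦ h.2, fun h ↦ ⟨h ▸ hs, h⟩⟩
  rw [Finset.sum_congr rfl hinner, Finset.sum_const, smul_eq_mul, hS, card_admissible_mod hp5]

/-- **The residue count**: for `p ≥ 5`, `k ≥ 1`, the pairs `(a, b) (mod p^{k+2})` with `a` admissible
and `4a³ + 27b² ≡ p^k·(unit) (mod p^{k+2})` number `(p-1)/2 · p^{k+1} · 2p(p-1)` ("`2(ℓ-1)` residue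
classes modulo `ℓ^{k+1}`" of `B` for each admissible `A`; `bsz_lemma18_card_residues_eq`).
[cite: BhargavaSkinnerZhang2014, Lemma 19 (proof)] -/
theorem card_pairs (hp5 : 5 ≤ p) {k : ℕ} (hk : 1 ≤ k) :
    ((Finset.univ : Finset (ZMod (p ^ (k + 2)) × ZMod (p ^ (k + 2)))).filter (fun r ↦
      (ZMod.castHom (dvd_pow k) (ZMod p) r.1 ≠ 0 ∧
        ∃ b : ZMod p, 4 * (ZMod.castHom (dvd_pow k) (ZMod p) r.1) ^ 3 + 27 * b ^ 2 = 0) ∧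
      ∃ z ∈ (Finset.univ : Finset (ZMod (p ^ 2))).filter
          (fun z ↦ ZMod.castHom dvd_sq (ZMod p) z ≠ 0),
        4 * r.1 ^ 3 + 27 * r.2 ^ 2 =
          (p : ZMod (p ^ (k + 2))) ^ k * (z.val : ZMod (p ^ (k + 2))))).card =
      (p - 1) / 2 * p ^ (k + 1) * (2 * (p * (p - 1))) := by
  haveI : NeZero (p ^ (k + 2)) := ⟨pow_ne_zero _ hp.out.ne_zero⟩
  set red := ZMod.castHom (dvd_pow k) (ZMod p) with hred
  set Zu := (Finset.univ : Finset (ZMod (p ^ 2))).filter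
      (fun z ↦ ZMod.castHom dvd_sq (ZMod p) z ≠ 0) with hZu
  set Padm : ZMod (p ^ (k + 2)) → Prop := fun a ↦
      red a ≠ 0 ∧ ∃ b : ZMod p, 4 * (red a) ^ 3 + 27 * b ^ 2 = 0 with hPadm
  have hcount : ∀ a : ZMod (p ^ (k + 2)), Padm a →
      ((Finset.univ : Finset (ZMod (p ^ (k + 2)))).filter (fun b ↦ ∃ z ∈ Zu,
        4 * a ^ 3 + 27 * b ^ 2 =
          (p : ZMod (p ^ (k + 2))) ^ k * (z.val : ZMod (p ^ (k + 2))))).card = 2 * Zu.card := by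
    intro a ha
    exact bsz_lemma18_card_residues_eq hp5 hk a ha.1 ha.2 Zu
  rw [Finset.card_filter, ← Finset.univ_product_univ, Finset.sum_product]
  have hinner : ∀ a : ZMod (p ^ (k + 2)),
      (∑ b : ZMod (p ^ (k + 2)), if Padm (a, b).1 ∧ ∃ z ∈ Zu,
          4 * (a, b).1 ^ 3 + 27 * (a, b).2 ^ 2 =
            (p : ZMod (p ^ (k + 2))) ^ k * (z.val : ZMod (p ^ (k + 2))) then 1 else 0) =
        if Padm a then 2 * Zu.card else 0 := by
    intro a
    by_cases ha : Padm a
    · rw [if_pos ha, ← hcount a ha, Finset.card_filter]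
      exact Finset.sum_congr rfl fun b _ ↦ by simp [ha]
    · rw [if_neg ha]
      exact Finset.sum_eq_zero fun b _ ↦ by simp [ha]
  have hadm : ((Finset.univ : Finset (ZMod (p ^ (k + 2)))).filter (fun x ↦ Padm x)).card =
      (p - 1) / 2 * p ^ (k + 1) := by
    simp only [hPadm]
    exact card_admissible hp5 k
  rw [Finset.sum_congr rfl fun a _ ↦ hinner a, Finset.sum_ite, Finset.sum_const_zero, add_zero,
    Finset.sum_const, smul_eq_mul, hadm, hZu, card_units_mod_sq]

end BSZLemma19

open BSZLemma19

/-! ### The density -/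

/-- **Bhargava–Skinner–Zhang, proof of Lemma 19, first display: for a prime `ℓ ≥ 5` and `k ≥ 1`, the
set `{ℓ ∤ A, ord_ℓ(4A³ + 27B²) = k}` (i.e. `ℓ^k ∥ 4A³ + 27B²`; `ord_ℓ Δ(A,B) = ord_ℓ(4A³+27B²)` as
`Δ = -16(4A³+27B²)`) has height density `(ℓ-1)²/ℓ^{k+2} · (1 - ℓ⁻¹⁰)⁻¹`** — the printed `ℓ`-adic measure
`(ℓ-1)²/ℓ^{k+2}`, divided by the measure `1 - ℓ⁻¹⁰` of the family as in §3.1 of the source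
(`hasHeightDensity_residues`). [cite: BhargavaSkinnerZhang2014, Lemma 19 (proof)] -/
theorem hasHeightDensity_ord_disc_eq {p : ℕ} [hp : Fact p.Prime] (hp5 : 5 ≤ p) {k : ℕ} (hk : 1 ≤ k) :
    HasHeightDensity (fun AB : ℤ × ℤ ↦ ¬ (p : ℤ) ∣ AB.1 ∧
        (p : ℤ) ^ k ∣ 4 * AB.1 ^ 3 + 27 * AB.2 ^ 2 ∧ ¬ (p : ℤ) ^ (k + 1) ∣ 4 * AB.1 ^ 3 + 27 * AB.2 ^ 2)
      (((p : ℝ) - 1) ^ 2 / (p : ℝ) ^ (k + 2) / (1 - 1 / (p : ℝ) ^ 10)) := by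
  haveI : NeZero (p ^ (k + 2)) := ⟨pow_ne_zero _ hp.out.ne_zero⟩
  set red := ZMod.castHom (dvd_pow (p := p) k) (ZMod p) with hred
  set Zu := (Finset.univ : Finset (ZMod (p ^ 2))).filter
      (fun z ↦ ZMod.castHom dvd_sq (ZMod p) z ≠ 0) with hZu
  set R : Finset (ZMod (p ^ (k + 2)) × ZMod (p ^ (k + 2))) :=
    (Finset.univ : Finset (ZMod (p ^ (k + 2)) × ZMod (p ^ (k + 2)))).filter (fun r ↦
      (red r.1 ≠ 0 ∧ ∃ b : ZMod p, 4 * (red r.1) ^ 3 + 27 * b ^ 2 = 0) ∧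
      ∃ z ∈ Zu, 4 * r.1 ^ 3 + 27 * r.2 ^ 2 =
          (p : ZMod (p ^ (k + 2))) ^ k * (z.val : ZMod (p ^ (k + 2)))) with hRdef
  -- membership
  have hmem : ∀ AB : ℤ × ℤ,
      (((AB.1 : ZMod (p ^ (k + 2))), (AB.2 : ZMod (p ^ (k + 2)))) ∈ R) ↔
        (¬ (p : ℤ) ∣ AB.1 ∧ (p : ℤ) ^ k ∣ 4 * AB.1 ^ 3 + 27 * AB.2 ^ 2 ∧
          ¬ (p : ℤ) ^ (k + 1) ∣ 4 * AB.1 ^ 3 + 27 * AB.2 ^ 2) := by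
    intro AB
    have hredA : red (AB.1 : ZMod (p ^ (k + 2))) = (AB.1 : ZMod p) := map_intCast _ _
    rw [hRdef, Finset.mem_filter]
    simp only [Finset.mem_univ, true_and, hZu, Finset.mem_filter, hredA]
    rw [show (4 * (AB.1 : ZMod (p ^ (k + 2))) ^ 3 + 27 * (AB.2 : ZMod (p ^ (k + 2))) ^ 2) =
        ((4 * AB.1 ^ 3 + 27 * AB.2 ^ 2 : ℤ) : ZMod (p ^ (k + 2))) by push_cast; ring]
    rw [show (∃ z, (ZMod.castHom dvd_sq (ZMod p)) z ≠ 0 ∧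
        ((4 * AB.1 ^ 3 + 27 * AB.2 ^ 2 : ℤ) : ZMod (p ^ (k + 2))) =
          (p : ZMod (p ^ (k + 2))) ^ k * (z.val : ZMod (p ^ (k + 2)))) ↔ _ from
      exists_unit_residue_iff (4 * AB.1 ^ 3 + 27 * AB.2 ^ 2)]
    rw [ne_eq, ZMod.intCast_zmod_eq_zero_iff_dvd]
    constructor
    · rintro ⟨⟨hA, -⟩, hk1, hk2⟩
      exact ⟨hA, hk1, hk2⟩
    · rintro ⟨hA, hk1, hk2⟩
      refine ⟨⟨hA, ?_⟩, hk1, hk2⟩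
      -- solvability modulo `p` from `p ∣ 4A³ + 27B²`
      refine ⟨(AB.2 : ZMod p), ?_⟩
      have h5 : (p : ℤ) ∣ 4 * AB.1 ^ 3 + 27 * AB.2 ^ 2 := (dvd_pow_self (p : ℤ) (by omega)).trans hk1
      have := (ZMod.intCast_zmod_eq_zero_iff_dvd _ p).mpr h5
      push_cast at this
      exact this
  have hR : ∀ AB : ℤ × ℤ, ((AB.1 : ZMod (p ^ (k + 2))), (AB.2 : ZMod (p ^ (k + 2)))) ∈ R →
      ¬ (p : ℤ) ∣ AB.1 := fun AB h ↦ ((hmem AB).mp h).1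
  have hcard : R.card = (p - 1) / 2 * p ^ (k + 1) * (2 * (p * (p - 1))) := by
    rw [hRdef, hZu]
    exact card_pairs hp5 hk
  have h := hasHeightDensity_residues hp.out (k + 2) R hR
  have hfun : (fun AB : ℤ × ℤ ↦ ((AB.1 : ZMod (p ^ (k + 2))), (AB.2 : ZMod (p ^ (k + 2)))) ∈ R) =
      (fun AB : ℤ × ℤ ↦ ¬ (p : ℤ) ∣ AB.1 ∧ (p : ℤ) ^ k ∣ 4 * AB.1 ^ 3 + 27 * AB.2 ^ 2 ∧
          ¬ (p : ℤ) ^ (k + 1) ∣ 4 * AB.1 ^ 3 + 27 * AB.2 ^ 2) :=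
    funext fun AB ↦ propext (hmem AB)
  -- the constant: `((p-1)/2 · p^{k+1} · 2p(p-1)) / p^{2(k+2)} = (p-1)²/p^{k+2}`
  have hodd : 2 ∣ p - 1 := by
    have := hp.out.eq_one_or_self_of_dvd 2
    have hp2 : p % 2 = 1 := by
      rcases Nat.even_or_odd p with he | ho
      · exfalso
        have h2 : 2 ∣ p := even_iff_two_dvd.mp he
        rcases hp.out.eq_one_or_self_of_dvd 2 h2 with h | h <;> omega
      · exact Nat.odd_iff.mp ho
    omega
  have hnat : ((p - 1) / 2 * p ^ (k + 1) * (2 * (p * (p - 1))) : ℕ) = (p - 1) ^ 2 * p ^ (k + 2) := by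
    obtain ⟨m, hm⟩ := hodd
    rw [hm, Nat.mul_div_cancel_left m two_pos]
    ring
  have hconst : ((R.card : ℕ) : ℝ) / (((p : ℕ) : ℝ) ^ (k + 2)) ^ 2 / (1 - 1 / ((p : ℕ) : ℝ) ^ 10) =
      ((p : ℝ) - 1) ^ 2 / (p : ℝ) ^ (k + 2) / (1 - 1 / (p : ℝ) ^ 10) := by
    rw [hcard, hnat]
    have hp1 : 1 ≤ p := hp.out.one_lt.le
    have hpR : (0 : ℝ) < p := by exact_mod_cast hp.out.pos
    push_cast [Nat.cast_sub hp1]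
    congr 1
    field_simp
  rwa [hfun, hconst] at h

/-- The same with `ord_p(4A³ + 27B²) = k` (`padicValInt`). [cite: BhargavaSkinnerZhang2014, Lemma 19 (proof)] -/
theorem hasHeightDensity_padicValInt_disc_eq {p : ℕ} [hp : Fact p.Prime] (hp5 : 5 ≤ p) {k : ℕ}
    (hk : 1 ≤ k) :
    HasHeightDensity (fun AB : ℤ × ℤ ↦ ¬ (p : ℤ) ∣ AB.1 ∧ padicValInt p (4 * AB.1 ^ 3 + 27 * AB.2 ^ 2) = k)
      (((p : ℝ) - 1) ^ 2 / (p : ℝ) ^ (k + 2) / (1 - 1 / (p : ℝ) ^ 10)) := by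
  have h := hasHeightDensity_ord_disc_eq hp5 hk
  have hfun : (fun AB : ℤ × ℤ ↦ ¬ (p : ℤ) ∣ AB.1 ∧ (p : ℤ) ^ k ∣ 4 * AB.1 ^ 3 + 27 * AB.2 ^ 2 ∧
          ¬ (p : ℤ) ^ (k + 1) ∣ 4 * AB.1 ^ 3 + 27 * AB.2 ^ 2) =
      (fun AB : ℤ × ℤ ↦ ¬ (p : ℤ) ∣ AB.1 ∧ padicValInt p (4 * AB.1 ^ 3 + 27 * AB.2 ^ 2) = k) := by
    funext AB
    apply propext
    refine and_congr_right fun _ ↦ ?_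
    constructor
    · rintro ⟨h1, h2⟩
      have hD : (4 * AB.1 ^ 3 + 27 * AB.2 ^ 2 : ℤ) ≠ 0 := fun h0 ↦ h2 (h0 ▸ dvd_zero _)
      have h1' := (padicValInt_dvd_iff (p := p) k _).mp h1
      have h2' : ¬ ((4 * AB.1 ^ 3 + 27 * AB.2 ^ 2 : ℤ) = 0 ∨ k + 1 ≤ padicValInt p (4 * AB.1 ^ 3 + 27 * AB.2 ^ 2)) :=
        fun h' ↦ h2 ((padicValInt_dvd_iff (p := p) (k + 1) _).mpr h')
      omega
    · intro hv
      have hk0 : (4 * AB.1 ^ 3 + 27 * AB.2 ^ 2 : ℤ) ≠ 0 := by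
        intro h0
        rw [h0, padicValInt.zero] at hv
        omega
      refine ⟨(padicValInt_dvd_iff (p := p) k _).mpr (Or.inr hv.ge), fun h' ↦ ?_⟩
      have := (padicValInt_dvd_iff (p := p) (k + 1) _).mp h'
      omega
  rwa [hfun] at h

end Literature.NumberTheory.EllipticCurves
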